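import Summits.Ventures.PercRepro.C005Eight
import Summits.Ventures.PercRepro.LemmaBM3

/-!
# The face bridge for a fixed graph: C-005 at every `p` from Lemma B on the face maps

`C005Seven.lean` proves C-005 for graphs with ≤ 7 / ≤ 8 edges by the two-copy expansion over
the faces `(u, v)` of the cube: each face term is nonnegative when the **face map**
`ρ ↦ markedPartition (embed u v ρ) m` satisfies Lemma B (`crossCount ≤ topBotCount`). Here the
same assembly is stated for a fixed graph with the face condition as a hypothesis
(`C005_of_faceMaps`); the faces with at most eight free edges are discharged by the landed
8-point code bound (`faceMap_lemmaB_of_card_le_eight`), and a face whose crossing configurations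
all have a `⊤` antipode has `crossCount = 0` (`crossCount_eq_zero_of_antipode_top`, with p6's
`cross4_ne_top` from `LemmaBM3.lean`).
-/

namespace PercRepro

open Finset

variable {V E : Type}

namespace MultiGraph

/-- The face map of `G` at the face `(u, v)` for the marks `m`: the marked partition of the
embedded face point. -/
def faceMap (G : MultiGraph V E) {k : ℕ} (m : Fin k → V) (u v : Config E) :
    Config (Face u v) → Setoid (Fin k) :=
  fun ρ => G.markedPartition (embed u v ρ) m

/-- The face map is monotone. -/
theorem monotone_faceMap (G : MultiGraph V E) (m : Fin 4 → V) (u v : Config E) :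
    Monotone (G.faceMap m u v) :=
  (G.monotone_markedPartition_four m).comp (embed_mono u v)

variable [Fintype E] [DecidableEq E]

/-- **Lemma B on every face with at most eight free edges** (the 8-point code bound). -/
theorem faceMap_lemmaB_of_card_le_eight (G : MultiGraph V E) (m : Fin 4 → V) (u v : Config E)
    (h8 : Fintype.card (Face u v) ≤ 8) :
    crossCount cross4 (G.faceMap m u v) ≤ topBotCount (G.faceMap m u v) :=
  crossCount_le_topBotCount_of_card_le_eight codeBound8_holds _ (G.monotone_faceMap m u v)
    (G.singleMergeMap_class m u v) h8

/-- **C-005 for `G` at every `p` from Lemma B on every face map** (the assembly of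
`C005Seven.lean` with the face condition as a hypothesis). -/
theorem C005_of_faceMaps (G : MultiGraph V E) (a b c d : V)
    (hB : ∀ u v : Config E, v ≤ u →
      crossCount cross4 (G.faceMap ![a, b, c, d] u v) ≤ topBotCount (G.faceMap ![a, b, c, d] u v))
    (p : E → ℝ) (hp : IsProb p) :
    prob p (G.partitionEvent ![a, b, c, d] ![0, 0, 1, 1]) *
        prob p (G.partitionEvent ![a, b, c, d] ![0, 1, 0, 1]) +
      prob p (G.partitionEvent ![a, b, c, d] ![0, 0, 1, 1]) *
        prob p (G.partitionEvent ![a, b, c, d] ![0, 1, 1, 0]) +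
      prob p (G.partitionEvent ![a, b, c, d] ![0, 1, 0, 1]) *
        prob p (G.partitionEvent ![a, b, c, d] ![0, 1, 1, 0]) ≤
    prob p (G.partitionEvent ![a, b, c, d] ![0, 0, 0, 0]) *
      prob p (G.partitionEvent ![a, b, c, d] ![0, 1, 2, 3]) := by
  classical
  have key : 0 ≤ nestedForm p (fun ω => G.markedPartition ω ![a, b, c, d])
      (fun ω => G.markedPartition ω ![a, b, c, d]) := by
    rw [nestedForm_self_eq_sum_faces]
    refine Finset.sum_nonneg fun uv _ => ?_
    refine mul_nonneg (mul_nonneg (weight_nonneg hp _) (weight_nonneg hp _)) ?_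
    split_ifs with hle
    · have h' : (crossCount cross4 (G.faceMap ![a, b, c, d] uv.1 uv.2) : ℝ) ≤
          topBotCount (G.faceMap ![a, b, c, d] uv.1 uv.2) := by
        exact_mod_cast hB uv.1 uv.2 hle
      have hsum := sum_crossKernel_compl cross4_injective (G.faceMap ![a, b, c, d] uv.1 uv.2)
      rw [show (∑ ρ : Config (Face uv.1 uv.2), nestedKernel
          (G.markedPartition (embed uv.1 uv.2 ρ) ![a, b, c, d])
          (G.markedPartition (embed uv.1 uv.2 ρᶜ) ![a, b, c, d])) =
        ∑ ρ : Config (Face uv.1 uv.2), crossKernel cross4 (G.faceMap ![a, b, c, d] uv.1 uv.2 ρ)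
          (G.faceMap ![a, b, c, d] uv.1 uv.2 ρᶜ) from rfl, hsum]
      linarith
    · exact le_rfl
  rw [G.nestedForm_markedPartition] at key
  linarith

end MultiGraph

/-- A face map whose crossing configurations all have a `⊤` antipode has `crossCount = 0`. -/
theorem crossCount_eq_zero_of_antipode_top {S : Type} [Fintype S] [DecidableEq S]
    (c : Config S → Setoid (Fin 4)) (h : ∀ ρ i, c ρ = cross4 i → c ρᶜ = ⊤) :
    crossCount cross4 c = 0 := by
  classical
  unfold crossCount
  rw [Finset.card_eq_zero, Finset.filter_eq_empty_iff]
  rintro ρ - ⟨i, j, -, hi, hj⟩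
  rw [h ρ i hi] at hj
  exact cross4_ne_top j hj.symm

end PercRepro
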